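import Literature.Topology.FourManifolds.BasinSetting
import HarnessLib

/-!
# Pairs of basin settings for two gradient-like fields of one Morse function (data for the
# two-field endgame of the Torelli half of Griffiths' theorem)

Topic `Literature/Topology/FourManifolds`; infrastructure for the TWO-FIELD endgame (E2) of the
Morse line for the Torelli criterion (`HandlebodyKernelExtensionTorelli.lean`; one-field endgame:
`BasinEndgame.lean`).  The line alters the gradient-like field by Milnor's Lemma 4.7 away from
the critical points, so it ends with two smooth gradient-like fields `ξ_A`, `ξ_B` for the same
Morse function `g` on `(W; ∅, ∂W)`, equal near the critical set.  Everything here is **proved**.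

* `Cobordism.CollarSetting.lower` — a collar setting with its level `a'` lowered to any
  `a'' ∈ (0, a']` (the level only has to be small);
* `Literature.Topology.FourManifolds.BasinPair g ξA ξB` — two basin settings
  (`BasinSetting.lean`) `A`, `B` for `(g, ξ_A)`, `(g, ξ_B)` with the SAME minimum `p₀`, collar
  level `a'` (hence the same push depth `κ` and push level `L`), Milnor chart `φ` at `p₀` and
  chart radius `r₀`;
* `BasinPair.nonempty` — such pairs exist when `ξ_A = ξ_B` near every critical point (Milnor's
  chart of `ξ_A` at `p₀` restricted to the open set of agreement, `restr_mem_maximalAtlas`, is a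
  Milnor chart for `ξ_B`).

## References

* J. Milnor, *Lectures on the h-cobordism theorem* (1965), Def. 3.1, proof of Thm. 3.4, Lemma 4.7
  and its Remark (PDF pp. 11–13, 25). [MilnorHCobordism1965]
* H. B. Griffiths, *Automorphisms of a 3-dimensional handlebody*, Abh. Math. Sem. Univ. Hamburg
  26 (1964), §§3–6. [GriffithsHB1964Handlebody]
-/

open scoped Manifold ContDiff Topology
open Set Function Filter Metric

noncomputable section

namespace Literature.Topology.FourManifolds

open Cobordism FourManifolds.Flow

universe u

/-! ### Lowering the level of a collar setting -/

namespace Cobordism.CollarSetting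

variable {n : ℕ} {M N : Type u} [TopologicalSpace M] [ChartedSpace (EuclideanSpace ℝ (Fin n)) M]
  [TopologicalSpace N] [ChartedSpace (EuclideanSpace ℝ (Fin n)) N]
  {c : Cobordism n M N} {f : c.W → ℝ} {ξ : Π x : c.W, TangentSpace (𝓡∂ (n + 1)) x}

/-- **Lowering the level of a collar setting**: the same flow-out input and cover with the level
`a'' ∈ (0, a']`. [cite: MilnorHCobordism1965, proof of Thm. 3.4 (PDF pp. 12–13)] -/
def lower (S : CollarSetting c f ξ) (a'' : ℝ) (h₀ : 0 < a'') (hle : a'' ≤ S.a') : CollarSetting c f ξ where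
  D := S.D
  Γ := S.Γ
  isMorseFunction := S.isMorseFunction
  contMDiff := S.contMDiff
  δ_le := S.δ_le
  f_eq := S.f_eq
  smul_eq := S.smul_eq
  pos := S.pos
  a' := a''
  a'_pos := h₀
  a'_le := hle.trans S.a'_le
  a'_lt := lt_of_le_of_lt hle S.a'_lt

/-- The level of the lowered collar setting. [folklore] -/
@[simp] theorem lower_a' (S : CollarSetting c f ξ) (a'' : ℝ) (h₀ : 0 < a'') (hle : a'' ≤ S.a') :
    (S.lower a'' h₀ hle).a' = a'' := rfl

end Cobordism.CollarSetting

/-! ### Pairs of basin settings -/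

variable {n : ℕ} {W : Type u} [TopologicalSpace W] [T2Space W] [SecondCountableTopology W]
  [CompactSpace W] [ChartedSpace (EuclideanHalfSpace (n + 1)) W] [IsManifold (𝓡∂ (n + 1)) ∞ W]

/-- **A pair of basin settings** for two gradient-like fields `ξ_A`, `ξ_B` of one Morse function
`g` on `(W; ∅, ∂W)`: two `BasinSetting`s with the same minimum, collar level, Milnor chart at
the minimum and chart radius. [cite: MilnorHCobordism1965, Def. 3.1, Lemma 4.7 (PDF pp. 11, 25)] -/
structure BasinPair (g : W → ℝ) (ξA ξB : Π x : W, TangentSpace (𝓡∂ (n + 1)) x) where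
  /-- the basin setting of `(g, ξ_A)` -/
  A : BasinSetting g ξA
  /-- the basin setting of `(g, ξ_B)` -/
  B : BasinSetting g ξB
  /-- same minimum -/
  p₀_eq : B.p₀ = A.p₀
  /-- same collar level -/
  a'_eq : B.S.a' = A.S.a'
  /-- same Milnor chart at the minimum -/
  φ_eq : B.φ = A.φ
  /-- same chart radius -/
  r₀_eq : B.r₀ = A.r₀

namespace BasinPair

variable {g : W → ℝ} {ξA ξB : Π x : W, TangentSpace (𝓡∂ (n + 1)) x}

/-- **Pairs of basin settings exist** for two smooth gradient-like fields of a Morse function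
on `(W; ∅, ∂W)` with a unique critical point of index `0`, equal near every critical point.
[cite: MilnorHCobordism1965, Def. 3.1, proof of Thm. 3.4, Lemma 4.7 Remark (PDF pp. 11–13, 25)] -/
theorem nonempty (hg : (Cobordism.ofBoundary n W).IsMorseFunction g)
    (hξAs : ContMDiff (𝓡∂ (n + 1)) (𝓡∂ (n + 1)).tangent ∞ fun x => (⟨x, ξA x⟩ : TangentBundle (𝓡∂ (n + 1)) W))
    (hξBs : ContMDiff (𝓡∂ (n + 1)) (𝓡∂ (n + 1)).tangent ∞ fun x => (⟨x, ξB x⟩ : TangentBundle (𝓡∂ (n + 1)) W))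
    (hξA : IsGradientLike (𝓡∂ (n + 1)) g ξA) (hξB : IsGradientLike (𝓡∂ (n + 1)) g ξB)
    (heq : ∀ p, IsMCriticalPt (𝓡∂ (n + 1)) g p → ∀ᶠ x in 𝓝 p, ξA x = ξB x)
    {p₀ : W} (hp₀ : criticalSetOfIndex (𝓡∂ (n + 1)) g 0 = {p₀}) : Nonempty (BasinPair g ξA ξB) := by
  classical
  have hgA : IsMorseAdapted (𝓡∂ (n + 1)) g := hg.isMorseAdapted_ofBoundary
  have hcont : Continuous g := hg.isMorse.contMDiff.continuous
  obtain ⟨β, hβ, -, hβg'⟩ := hg.exists_margin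
  have hβg : ∀ p, IsMCriticalPt (𝓡∂ (n + 1)) g p → 2 * β < g p ∧ g p < 1 - 2 * β := fun p hp => hβg' p hp
  -- the two collars, with a common level
  obtain ⟨SA₀, hSAβ⟩ := Cobordism.IsMorseFunction.exists_collarSetting
    (c := (Cobordism.ofBoundary n W).symm) hg.symm hξAs.neg_section (hg.isGradientLike_const_sub_neg hξA 1) hβ
  obtain ⟨SB₀, hSBβ⟩ := Cobordism.IsMorseFunction.exists_collarSetting
    (c := (Cobordism.ofBoundary n W).symm) hg.symm hξBs.neg_section (hg.isGradientLike_const_sub_neg hξB 1) hβ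
  set a'' : ℝ := min SA₀.a' SB₀.a' with ha''
  have ha''pos : 0 < a'' := lt_min SA₀.a'_pos SB₀.a'_pos
  set SA := SA₀.lower a'' ha''pos (min_le_left _ _) with hSA
  set SB := SB₀.lower a'' ha''pos (min_le_right _ _) with hSB
  have hSAa : SA.a' = a'' := rfl
  have hSBa : SB.a' = a'' := rfl
  have ha''β : a'' < β := (min_le_left _ _).trans_lt hSAβ
  have hcrit : ∀ p, IsMCriticalPt (𝓡∂ (n + 1)) g p → g p < 1 - a'' := fun p hp => by
    have := (hβg p hp).2; linarith
  -- the minimum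
  have hp₀mem : p₀ ∈ criticalSetOfIndex (𝓡∂ (n + 1)) g 0 := by rw [hp₀]; exact mem_singleton p₀
  have hp₀c : IsMCriticalPt (𝓡∂ (n + 1)) g p₀ := hp₀mem.1
  have hp₀i : morseIndex (𝓡∂ (n + 1)) g p₀ = 0 := hp₀mem.2
  have huniq : ∀ q, IsMCriticalPt (𝓡∂ (n + 1)) g q → morseIndex (𝓡∂ (n + 1)) g q = 0 → q = p₀ := by
    intro q hq hqi
    have : q ∈ criticalSetOfIndex (𝓡∂ (n + 1)) g 0 := ⟨hq, hqi⟩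
    rw [hp₀] at this
    exact this
  have hp₀int : (𝓡∂ (n + 1)).IsInteriorPoint p₀ := hgA.isInteriorPoint_of_isMCriticalPt hp₀c
  have hgp₀ : 0 < g p₀ := by have := (hβg p₀ hp₀c).1; linarith
  have hgp₀' : g p₀ < 1 - 2 * β := (hβg p₀ hp₀c).2
  -- Milnor's chart of `ξ_A` at `p₀`, restricted to the open set where `ξ_A = ξ_B`
  obtain ⟨φ₀, hφ₀, hp₀φ₀, hgφ₀, hξφ₀⟩ :=
    hξA.exists_chart_morseIndex (hg.isMorse.1.of_le (by norm_cast)) hp₀c hp₀int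
  rw [hp₀i] at hgφ₀ hξφ₀
  obtain ⟨U, hUeq, hUo, hpU⟩ := eventually_nhds_iff.1 (heq p₀ hp₀c)
  set φ := φ₀.restr U with hφdef
  have hφ : φ ∈ IsManifold.maximalAtlas (𝓡∂ (n + 1)) ∞ W := restr_mem_maximalAtlas (contDiffGroupoid ∞ (𝓡∂ (n + 1))) hφ₀ hUo
  have hsrc : φ.source = φ₀.source ∩ U := φ₀.restr_source' U hUo
  have hcoe : ((φ.extend (𝓡∂ (n + 1))) : W → EuclideanSpace ℝ (Fin (n + 1))) = φ₀.extend (𝓡∂ (n + 1)) := by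
    funext x
    simp only [hφdef, OpenPartialHomeomorph.extend_coe, Function.comp_apply, OpenPartialHomeomorph.restr_apply]
  have hp₀φ : p₀ ∈ φ.source := by rw [hsrc]; exact ⟨hp₀φ₀, hpU⟩
  set u₀ : EuclideanSpace ℝ (Fin (n + 1)) := φ.extend (𝓡∂ (n + 1)) p₀ with hu₀
  have hgφ' : ∀ q ∈ φ.source, g q = g p₀ + ‖φ.extend (𝓡∂ (n + 1)) q - u₀‖ ^ 2 := fun q hq => by
    rw [hsrc] at hq
    rw [hu₀, hcoe, hgφ₀ q hq.1, BasinSetting.milnorQuadratic_index_zero]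
  have hξAφ : ∀ q ∈ φ.source, mfderiv (𝓡∂ (n + 1)) 𝓘(ℝ, EuclideanSpace ℝ (Fin (n + 1))) (φ.extend (𝓡∂ (n + 1))) q (ξA q) =
      φ.extend (𝓡∂ (n + 1)) q - u₀ := fun q hq => by
    rw [hsrc] at hq
    rw [hu₀, hcoe, hξφ₀ q hq.1, milnorModelField_zero_index]
  have hξBφ : ∀ q ∈ φ.source, mfderiv (𝓡∂ (n + 1)) 𝓘(ℝ, EuclideanSpace ℝ (Fin (n + 1))) (φ.extend (𝓡∂ (n + 1))) q (ξB q) =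
      φ.extend (𝓡∂ (n + 1)) q - u₀ := fun q hq => by
    have hq' := hq; rw [hsrc] at hq'
    rw [← hUeq q hq'.2]; exact hξAφ q hq
  have htarget : (φ.extend (𝓡∂ (n + 1))).target ∈ 𝓝 u₀ :=
    nhds_of_nhdsWithin_of_nhds
      (range_mem_nhds_extend_of_isInteriorPoint (n := ∞) (by simp) hφ hp₀φ hp₀int)
      (φ.extend_target_mem_nhdsWithin hp₀φ)
  obtain ⟨r₁, hr₁, hr₁t⟩ := Metric.nhds_basis_closedBall.mem_iff.1 htarget
  have hsrc' : φ.source = (φ.extend (𝓡∂ (n + 1))).source := (φ.extend_source (I := 𝓡∂ (n + 1))).symm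
  set V : Set W := φ.source ∩ φ.extend (𝓡∂ (n + 1)) ⁻¹' ball u₀ r₁ with hV
  have hVo : IsOpen V := by
    have hc : ContinuousOn (φ.extend (𝓡∂ (n + 1))) φ.source := by rw [hsrc']; exact φ.continuousOn_extend
    exact hc.isOpen_inter_preimage φ.open_source isOpen_ball
  have hpV : p₀ ∈ V := ⟨hp₀φ, by rw [mem_preimage, ← hu₀]; exact mem_ball_self hr₁⟩
  set K : Set W := Vᶜ with hK
  have hKc : IsCompact K := hVo.isClosed_compl.isCompact
  obtain ⟨m₀, hm₀p, hm₀K⟩ : ∃ m₀, g p₀ < m₀ ∧ ∀ q ∈ K, m₀ ≤ g q := by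
    rcases K.eq_empty_or_nonempty with hKe | hKne
    · exact ⟨g p₀ + 1, by linarith, fun q hq => by rw [hKe] at hq; exact hq.elim⟩
    · obtain ⟨q₀, hq₀K, hq₀⟩ := hKc.exists_isMinOn hKne hcont.continuousOn
      have hq₀p : q₀ ≠ p₀ := fun h => hq₀K (h ▸ hpV)
      exact ⟨g q₀, hgA.apply_lt_of_ne_of_index_zero hp₀c huniq hq₀p, fun q hq => isMinOn_iff.1 hq₀ q hq⟩
  have hfin : (criticalSet (𝓡∂ (n + 1)) g).Finite := IsMorse.finite_criticalSet_holds hg.isMorse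
  obtain ⟨m₁, hm₁p, hm₁⟩ : ∃ m₁, g p₀ < m₁ ∧ ∀ q, IsMCriticalPt (𝓡∂ (n + 1)) g q → q ≠ p₀ → m₁ ≤ g q := by
    rcases (criticalSet (𝓡∂ (n + 1)) g \ {p₀}).eq_empty_or_nonempty with he | hne
    · refine ⟨g p₀ + 1, by linarith, fun q hq hqp => ?_⟩
      have : q ∈ criticalSet (𝓡∂ (n + 1)) g \ {p₀} := ⟨hq, hqp⟩
      rw [he] at this
      exact this.elim
    · obtain ⟨q₀, hq₀, hmin⟩ := (hfin.sdiff).exists_minimalFor g _ hne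
      refine ⟨g q₀, hgA.apply_lt_of_ne_of_index_zero hp₀c huniq hq₀.2, fun q hq hqp => ?_⟩
      by_contra hlt
      push Not at hlt
      exact absurd (hmin ⟨hq, hqp⟩ hlt.le) (not_le.2 hlt)
  -- the radius
  set r : ℝ := min (r₁ / 2) (min 1 (min ((m₀ - g p₀) / 2) (min ((m₁ - g p₀) / 2) β))) with hr
  have hrpos : 0 < r :=
    lt_min (by linarith) (lt_min one_pos (lt_min (by linarith) (lt_min (by linarith) hβ)))
  have hrr₁ : r < r₁ := (min_le_left _ _).trans_lt (by linarith)
  have hr1 : r ≤ 1 := (min_le_right _ _).trans (min_le_left _ _)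
  have hrm : r ≤ (m₀ - g p₀) / 2 :=
    (min_le_right _ _).trans ((min_le_right _ _).trans (min_le_left _ _))
  have hrm₁ : r ≤ (m₁ - g p₀) / 2 :=
    (min_le_right _ _).trans ((min_le_right _ _).trans ((min_le_right _ _).trans (min_le_left _ _)))
  have hrβ : r ≤ β :=
    (min_le_right _ _).trans ((min_le_right _ _).trans ((min_le_right _ _).trans (min_le_right _ _)))
  have hrsq : r ^ 2 ≤ r := by nlinarith
  have hcm : g p₀ + r ^ 2 < m₀ := by linarith
  have hcm₁ : g p₀ + r ^ 2 < m₁ := by linarith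
  have hclevel : g p₀ + r ^ 2 < 1 - a'' := by linarith
  have hball : closedBall u₀ r ⊆ (φ.extend (𝓡∂ (n + 1))).target :=
    (closedBall_subset_closedBall hrr₁.le).trans hr₁t
  have hsub : g ⁻¹' Iic (g p₀ + r ^ 2) ⊆ φ.source := by
    intro q hq
    by_contra hqs
    have hqK : q ∈ K := fun hqV => hqs hqV.1
    have := hm₀K q hqK
    simp only [mem_preimage, mem_Iic] at hq
    linarith
  -- the two slab flows
  have ha₀ : 0 < g p₀ / 2 := by linarith
  have hκ' : pushConst * a'' / 4 ≤ a'' / 4 := by have := pushConst_le_one; nlinarith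
  have hκ : 0 < pushConst * a'' / 4 := by have := pushConst_pos; positivity
  have ha₁ : 1 - pushConst * a'' / 4 < 1 := by linarith
  have ha''le : a'' ≤ 1 / 8 := (min_le_left _ _).trans SA₀.a'_le_eighth
  have ha₀₁ : g p₀ / 2 < 1 - pushConst * a'' / 4 := by linarith
  obtain ⟨θA, hθA⟩ := hg.exists_slabFlow hξAs hξA ha₀ ha₀₁ ha₁
  obtain ⟨θB, hθB⟩ := hg.exists_slabFlow hξBs hξB ha₀ ha₀₁ ha₁
  have hlow : SA.a' < g p₀ := by rw [hSAa]; linarith [(hβg p₀ hp₀c).1]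
  refine ⟨⟨⟨hg, hξAs, hξA, SA, hcrit, p₀, hlow, hp₀, θA, hθA, φ, hφ, hp₀φ, hgφ', hξAφ, r, hrpos, hball, hsub,
    fun q hq hqp => hcm₁.trans_le (hm₁ q hq hqp), hclevel⟩,
    ⟨hg, hξBs, hξB, SB, hcrit, p₀, hlow, hp₀, θB, hθB, φ, hφ, hp₀φ, hgφ', hξBφ, r, hrpos, hball, hsub,
    fun q hq hqp => hcm₁.trans_le (hm₁ q hq hqp), hclevel⟩, rfl, rfl, rfl, rfl⟩⟩

variable (P : BasinPair g ξA ξB)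

/-- The two settings have the same push depth `κ`. [folklore] -/
theorem κ_eq : P.B.κ = P.A.κ := by unfold BasinSetting.κ; rw [P.a'_eq]

/-- The two settings have the same push level `L`. [folklore] -/
theorem L_eq : P.B.L = P.A.L := by unfold BasinSetting.L; rw [P.κ_eq]

/-- The two settings have the same slab bottom `lo`. [folklore] -/
theorem lo_eq : P.B.lo = P.A.lo := by unfold BasinSetting.lo; rw [P.p₀_eq]

/-- The two settings have the same slab top `hi`. [folklore] -/
theorem hi_eq : P.B.hi = P.A.hi := by unfold BasinSetting.hi; rw [P.κ_eq]

/-- The two settings have the same chart-sphere level `sph`. [folklore] -/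
theorem sph_eq : P.B.sph = P.A.sph := by unfold BasinSetting.sph; rw [P.p₀_eq, P.r₀_eq]

end BasinPair

end Literature.Topology.FourManifolds
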